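import Literature.NumberTheory.GaloisRepresentations.LubinTateColemanUnitsImageEquivTwo
import Literature.NumberTheory.GaloisRepresentations.LubinTateColemanTwoVariableGaloisCyclicTwo
import HarnessLib

/-!
# The bijection `𝒰¹_∞ ≅ N` is `Γ_F`-EQUIVARIANT: `Col(σ̃·β) = 𝒯_{σ̃}(Col β)` for the explicit `Λ`-linear operators
# `𝒯_{σ̃} = σ_{χ(σ̃)} ∘ (C g_{σ̃} • ·) ∘ (shift by s_{σ̃})` on `M = (ColemanCoordModule)^{ℤ/d}`, which preserve `N = unitsImage`

De Shalit, *Iwasawa theory of elliptic curves with complex multiplication* (1987), Ch. I §3.1 ("`ℤ_p⟦𝒢⟧ = Λ[Δ]`"), §3.4 Lemma (ii), §3.8 (17);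
Ch. III §1.3: `i : 𝒰 ⊗̂ 𝒪 → Λ(𝒢, 𝒪)` is a homomorphism of `ℤ_p⟦𝒢⟧`-modules.  In the tree the Galois equivariance of the two-variable
transform is `colemanTransformProd₂_galois_eq` (`Col(σ̃β)_j = (1 + D_{χ(σ̃)})(C(g_σ̃)·Col(β)_{j − s_σ̃})`, Amice pair `(g, s)` of `σ̃|_{E_∞}`,
`exists_amicePair_galois`).  THIS file restates it for the MODULE packaging (`colemanImage`, `unitTwistₗ`, `unitsImage`):

* `indexShiftₗ s` (the `ℤ/d`-index shift = `LinearMap.funLeft … (· − s)`), ★ **`galOpₗ v g s := (unitTwistₗ v).compLeft ∘ (C g • ·) ∘ indexShiftₗ s`** — the `Λ`-LINEAR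
  operator of a Galois element with Lubin–Tate character `v` and Amice pair `(g, s)`;
* ★★★ **`colemanImage_galAct`** — `Col(σ̃·β) = galOpₗ (χ σ̃) g s (Col β)` for every `σ̃ ∈ Γ_F` and Amice pair `(g, s)` of `σ̃|_{E_∞}`;
  `colemanImage_galAct_of_forall_smul_eq` (`σ̃` fixing `E_∞`: `Col(σ̃β) = σ_{χ(σ̃)}(Col β)`), `colemanImage_galAct_frob`
  (`Col(σ₀β) = σ_{χ(σ₀)}(Φ_1(Col β))`, Frobenius = shift ⊗ `(1+X)`);
* ★ **`galOpₗ_mem_unitsImage`** — `N` is stable under every `galOpₗ v g s` (assembled from `unitTwistₗ_compLeft_mem_unitsImage`,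
  `IsAdmissibleLevel.C_mul`, `frobShiftₗ`/shift stability): `N ≤ M` is a sub-`Λ(𝒢)`-module for the FULL Galois group of the two-variable
  local tower, and `𝒰¹_∞ ≅ N` (`colemanImageEquiv`) intertwines the Galois action with `σ̃ ↦ galOpₗ (χ σ̃) g_σ̃ s_σ̃`.

Everything PROVED (0 sorry, no named facts); definitions `indexShiftₗ`, `galOpₗ`, `shiftExp`.

## References
* E. de Shalit, *Iwasawa theory of elliptic curves with complex multiplication* (1987), Ch. I §3.1, §3.4 Lemma (ii), §3.8 (17); Ch. III §1.3.
  [deShalit1987]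
-/

noncomputable section

namespace Literature.NumberTheory.GaloisRepresentations
section UnitsImageGaloisTwo

open GaloisRepresentations.IsNonarchimedeanLocalField LubinTate ValuativeRel Field Finset

variable {F : Type} [Field F] [ValuativeRel F] [TopologicalSpace F] [IsNonarchimedeanLocalField F]

attribute [local instance] ltNormUniformSpace ltNormIsUniformAddGroup rk1 nF nE fintypeResidueField

variable {p : ℕ} [hp : Fact p.Prime] {d : ℕ} (hd : d.Coprime p)
variable {π : 𝒪[F]} (hπ : (valuation F).IsUniformizer (π : F))
variable (E : ℕ → IntermediateField F (AlgebraicClosure F)) [∀ m, FiniteDimensional F (E m)] [∀ m, Normal F (E m)]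
  [∀ m, IsGalois F (E m)] (hmono : Monotone E) (hE : ∀ m, E m ≤ maxUnramified F) (hdeg : ∀ m, Module.finrank F (E m) = d * p ^ m)
  {σ₀ : absoluteGaloisGroup F} (hσ₀ : IsAbsArithFrob σ₀) (hq : residueFieldCard F = 2)
variable (u : (LTCoeff F)ˣ) (hu : LTCoeff.of F π = residueFieldCard F * u) (γ : 𝒪[F]ˣ)

/-! ### The `Λ`-linear operators: index shift, and `𝒯 = σ_v ∘ (C g •) ∘ shift_s` -/

section Ops

variable [IsAdicComplete (Ideal.span {intBase F (LTCoeff.of F π)}) (PowerSeries 𝒪[F])]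

/-- **The `ℤ/d`-index shift `(indexShiftₗ s G)(j) := G(j − s)`** on `M = (ColemanCoordModule)^{ℤ/d}` (the `ℤ/d`-part of the unramified
Galois group acting through the regular representation) — Mathlib's `LinearMap.funLeft` along `j ↦ j − s`. [cite: deShalit1987, Ch. I §3.1] -/
def indexShiftₗ (s : ZMod d) : (ZMod d → ColemanCoordModule hπ hq (intBase F) u hu γ) →ₗ[PowerSeries (PowerSeries 𝒪[F])]
    (ZMod d → ColemanCoordModule hπ hq (intBase F) u hu γ) :=
  LinearMap.funLeft _ _ fun j => j - s

omit hp in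
/-- Unfolding `indexShiftₗ`. [cite: deShalit1987, Ch. I §3.1] -/
@[simp] theorem indexShiftₗ_apply (s : ZMod d) (G : ZMod d → ColemanCoordModule hπ hq (intBase F) u hu γ) (j : ZMod d) :
    indexShiftₗ hπ hq u hu γ s G j = G (j - s) := rfl

/-- ★ **`galOpₗ v g s := σ_v ∘ (C g • ·) ∘ shift_s`** — the `Λ`-linear operator on `M` attached to a Galois element with Lubin–Tate
character `v ∈ 𝒪_F^×` and Amice pair `(g, s) ∈ 𝒪_F⟦X⟧ × ℤ/d` of its restriction to `E_∞`. [cite: deShalit1987, Ch. I §3.1, §3.4 Lemma (ii)] -/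
def galOpₗ (v : 𝒪[F]ˣ) (g : PowerSeries 𝒪[F]) (s : ZMod d) :
    (ZMod d → ColemanCoordModule hπ hq (intBase F) u hu γ) →ₗ[PowerSeries (PowerSeries 𝒪[F])]
      (ZMod d → ColemanCoordModule hπ hq (intBase F) u hu γ) :=
  (unitTwistₗ hπ hq (intBase F) u hu γ v).compLeft (ZMod d) ∘ₗ
    (LinearMap.lsmul (PowerSeries (PowerSeries 𝒪[F])) _ (PowerSeries.C g : PowerSeries (PowerSeries 𝒪[F]))) ∘ₗ indexShiftₗ hπ hq u hu γ s

omit hp in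
/-- Unfolding `galOpₗ`: `(𝒯 G)(j) = σ_v (C g • G(j − s))`. [cite: deShalit1987, Ch. I §3.1, §3.4 Lemma (ii)] -/
theorem galOpₗ_apply (v : 𝒪[F]ˣ) (g : PowerSeries 𝒪[F]) (s : ZMod d) (G : ZMod d → ColemanCoordModule hπ hq (intBase F) u hu γ) (j : ZMod d) :
    galOpₗ hπ hq u hu γ v g s G j =
      unitTwistₗ hπ hq (intBase F) u hu γ v ((PowerSeries.C g : PowerSeries (PowerSeries 𝒪[F])) • G (j - s)) := rfl

omit hp in
/-- … on the underlying series: `toPS ((𝒯 G)(j)) = C g·toPS(G(j − s)) + D_v (C g·toPS(G(j − s)))`. [cite: deShalit1987, Ch. I §3.4 Lemma (ii), §3.8 (17)] -/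
theorem toPS_galOpₗ_apply (v : 𝒪[F]ˣ) (g : PowerSeries 𝒪[F]) (s : ZMod d) (G : ZMod d → ColemanCoordModule hπ hq (intBase F) u hu γ)
    (j : ZMod d) :
    TActModule.toPS (galOpₗ hπ hq u hu γ v g s G j) =
      PowerSeries.C g * TActModule.toPS (G (j - s)) +
        twistLinearBase hπ hq (intBase F) u v (PowerSeries.C g * TActModule.toPS (G (j - s))) := by
  rw [galOpₗ_apply, toPS_unitTwistₗ, TActModule.toPS_smul, tAct_C, add_comm]

end Ops

/-! ### `Col(σ̃·β) = 𝒯_{σ̃}(Col β)` -/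

variable [NeZero d] [IsAdicComplete (Ideal.span {(p : 𝒪[F])}) 𝒪[F]]
variable {θ : ∀ m, unitBall (E m)} (hθ : ∀ m, IsIntegralNormalGen (E m) (θ m))
  (hcoh : ∀ m, unitBallTrace (hmono (Nat.le_succ m)) (θ (m + 1)) = θ m)

include hdeg in
/-- ★★★ **`Col(σ̃·β) = 𝒯_{σ̃}(Col β)`**: for every `σ̃ ∈ Γ_F` with Amice pair `(g, s)` of `σ̃|_{E_∞}` and every baseNorm-coherent family `β`,
`colemanImage (σ̃·β) = galOpₗ (χ σ̃) g s (colemanImage β)` — the module form of `colemanTransformProd₂_galois_eq`.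
[cite: deShalit1987, Ch. I §3.4 Lemma (ii), §3.8 (17); Ch. III §1.3] -/
theorem colemanImage_galAct [IsAdicComplete (Ideal.span {intBase F (LTCoeff.of F π)}) (PowerSeries 𝒪[F])]
    {β : ∀ m, RelNormCoherentUnits hπ (E m)} (hβ : ∀ m, (β (m + 1)).baseNorm hπ (hmono (Nat.le_succ m)) = β m)
    (σ : absoluteGaloisGroup F) {g : PowerSeries 𝒪[F]} {s : ZMod d}
    (hg : ∀ m, ∃ a : ℕ, (∀ x : E m, σ • (x : AlgebraicClosure F) = (σ₀ ^ a) • (x : AlgebraicClosure F)) ∧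
      ((1 + PowerSeries.X : PowerSeries 𝒪[F]) ^ p ^ m - 1) ∣ g - (1 + PowerSeries.X) ^ a ∧ (a : ZMod d) = s) :
    colemanImage hd hπ E hmono hE hdeg hσ₀ hq u hu γ hθ hcoh (β := fun m => (β m).galAct σ) (galAct_baseNormCoherent hπ E hmono σ hβ) =
      galOpₗ hπ hq u hu γ (lubinTateChar hπ σ) g s (colemanImage hd hπ E hmono hE hdeg hσ₀ hq u hu γ hθ hcoh hβ) := by
  funext j
  apply TActModule.toPS_injective
  rw [toPS_galOpₗ_apply]
  exact colemanTransformProd₂_galois_eq p d hd hπ hq E hmono hE hdeg hσ₀ hθ hcoh u hu hβ σ hg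
    (isTransformProd_colemanImage hd hπ E hmono hE hdeg hσ₀ hq u hu γ hθ hcoh hβ)
    (isTransformProd_colemanImage hd hπ E hmono hE hdeg hσ₀ hq u hu γ hθ hcoh (β := fun m => (β m).galAct σ) (galAct_baseNormCoherent hπ E hmono σ hβ)) j

include hmono hE hdeg hσ₀ in
/-- **Existence form**: for every `σ̃ ∈ Γ_F` there are `g, s` with `Col(σ̃β) = galOpₗ (χ σ̃) g s (Col β)` for ALL coherent `β`.
[cite: deShalit1987, Ch. I §3.1, §3.8 (17)] -/
theorem exists_colemanImage_galAct_eq [IsAdicComplete (Ideal.span {intBase F (LTCoeff.of F π)}) (PowerSeries 𝒪[F])]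
    (σ : absoluteGaloisGroup F) :
    ∃ (g : PowerSeries 𝒪[F]) (s : ZMod d), ∀ {β : ∀ m, RelNormCoherentUnits hπ (E m)}
      (hβ : ∀ m, (β (m + 1)).baseNorm hπ (hmono (Nat.le_succ m)) = β m),
      colemanImage hd hπ E hmono hE hdeg hσ₀ hq u hu γ hθ hcoh (β := fun m => (β m).galAct σ) (galAct_baseNormCoherent hπ E hmono σ hβ) =
        galOpₗ hπ hq u hu γ (lubinTateChar hπ σ) g s (colemanImage hd hπ E hmono hE hdeg hσ₀ hq u hu γ hθ hcoh hβ) := by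
  obtain ⟨g, s, hg⟩ := exists_amicePair_galois p d E hmono hE hdeg hσ₀ σ
  exact ⟨g, s, fun hβ => colemanImage_galAct hd hπ E hmono hE hdeg hσ₀ hq u hu γ hθ hcoh hβ σ hg⟩

include hdeg in
/-- **`σ̃` fixing `E_∞`** (the Lubin–Tate inertia of the two-variable tower): `Col(σ̃β) = σ_{χ(σ̃)}(Col β)` componentwise.
[cite: deShalit1987, Ch. I §3.4 Lemma (ii)] -/
theorem colemanImage_galAct_of_forall_smul_eq [IsAdicComplete (Ideal.span {intBase F (LTCoeff.of F π)}) (PowerSeries 𝒪[F])]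
    {β : ∀ m, RelNormCoherentUnits hπ (E m)} (hβ : ∀ m, (β (m + 1)).baseNorm hπ (hmono (Nat.le_succ m)) = β m)
    {σ : absoluteGaloisGroup F} (hσE : ∀ m (x : E m), σ • (x : AlgebraicClosure F) = x) :
    colemanImage hd hπ E hmono hE hdeg hσ₀ hq u hu γ hθ hcoh (β := fun m => (β m).galAct σ) (galAct_baseNormCoherent hπ E hmono σ hβ) =
      (unitTwistₗ hπ hq (intBase F) u hu γ (lubinTateChar hπ σ)).compLeft (ZMod d)
        (colemanImage hd hπ E hmono hE hdeg hσ₀ hq u hu γ hθ hcoh hβ) := by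
  rw [colemanImage_galAct hd hπ E hmono hE hdeg hσ₀ hq u hu γ hθ hcoh hβ σ
    (fun m => amicePair_galois_of_forall_smul_eq (p := p) (d := d) (E := E) hσE m)]
  funext j
  rw [galOpₗ_apply, LinearMap.compLeft_apply, Function.comp_apply, map_one, one_smul, sub_zero]

include hdeg in
/-- **The Frobenius `σ₀`**: `Col(σ₀β) = σ_{χ(σ₀)}((1+X) • Col β(· − 1))` — shift ⊗ `(1+X)`, twisted by the Lubin–Tate character of the
chosen Frobenius lift. [cite: deShalit1987, Ch. I §3.1, §3.8 (17)] -/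
theorem colemanImage_galAct_frob [IsAdicComplete (Ideal.span {intBase F (LTCoeff.of F π)}) (PowerSeries 𝒪[F])]
    {β : ∀ m, RelNormCoherentUnits hπ (E m)} (hβ : ∀ m, (β (m + 1)).baseNorm hπ (hmono (Nat.le_succ m)) = β m) :
    colemanImage hd hπ E hmono hE hdeg hσ₀ hq u hu γ hθ hcoh (β := fun m => (β m).galAct σ₀) (galAct_baseNormCoherent hπ E hmono σ₀ hβ) =
      galOpₗ hπ hq u hu γ (lubinTateChar hπ σ₀) (1 + PowerSeries.X) 1 (colemanImage hd hπ E hmono hE hdeg hσ₀ hq u hu γ hθ hcoh hβ) :=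
  colemanImage_galAct hd hπ E hmono hE hdeg hσ₀ hq u hu γ hθ hcoh hβ σ₀ fun m => amicePair_galois_frob (p := p) (d := d) (E := E) σ₀ m

/-! ### `N` is stable under every `𝒯` -/

/-- **`e_m := p^m · ((p^m)⁻¹ mod d).val`** — a natural number divisible by `p^m` and `≡ 1 (mod d)` (`p ∤ d`): the exponent realising a pure
`ℤ/d`-shift as a Frobenius power at level `m`. [cite: deShalit1987, Ch. I §3.1] -/
def shiftExp (p d m : ℕ) : ℕ := p ^ m * (((p ^ m : ℕ) : ZMod d)⁻¹).val

omit hp [NeZero d] in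
/-- `p^m ∣ e_m`. [cite: deShalit1987, Ch. I §3.1] -/
theorem pow_dvd_shiftExp (m : ℕ) : p ^ m ∣ shiftExp p d m := dvd_mul_right _ _

omit hp in
include hd in
/-- `(e_m : ℤ/d) = 1`. [cite: deShalit1987, Ch. I §3.1] -/
theorem natCast_shiftExp (m : ℕ) : ((shiftExp p d m : ℕ) : ZMod d) = 1 := by
  rw [shiftExp, Nat.cast_mul, ZMod.natCast_val, ZMod.cast_id', id]
  exact ZMod.mul_inv_of_unit _ ((ZMod.isUnit_iff_coprime (p ^ m) d).mpr (hd.symm.pow_left m))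

variable {E} in
omit [IsAdicComplete (Ideal.span {(p : 𝒪[F])}) 𝒪[F]] in
include hd hE hdeg hσ₀ in
/-- ★ **Admissibility is stable under the pure `ℤ/d`-shift `x ↦ x(· − s)`** (`= φ_m^{t}` with `t = s·e_m`: `t ≡ s (mod d)`, `p^m ∣ t` so
`(1+X)^t ≡ 1 (mod ω_m)`). [cite: deShalit1987, Ch. I §3.1, §3.8 (17)] -/
theorem IsAdmissibleLevel.shift {m : ℕ} {u' : 𝒪[F]} {x : ZMod d → PowerSeries 𝒪[F]}
    (h : IsAdmissibleLevel p d hd σ₀ (hθ m) u' x) (s : ZMod d) : IsAdmissibleLevel p d hd σ₀ (hθ m) u' (fun j => x (j - s)) := by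
  have ht := h.frobPow hE hdeg hσ₀ hθ (s.val * shiftExp p d m)
  refine ht.congr_of_dvd fun j => ?_
  have hs : ((s.val * shiftExp p d m : ℕ) : ZMod d) = s := by
    rw [Nat.cast_mul, natCast_shiftExp hd, mul_one, ZMod.natCast_zmod_val]
  have h0 : s.val * shiftExp p d m ≡ 0 [MOD p ^ m] :=
    (Nat.modEq_zero_iff_dvd.mpr (dvd_mul_of_dvd_right (pow_dvd_shiftExp (p := p) (d := d) m) _))
  rw [hs]
  have e : (1 + PowerSeries.X : PowerSeries 𝒪[F]) ^ (s.val * shiftExp p d m) * x (j - s) - x (j - s) =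
      ((1 + PowerSeries.X) ^ (s.val * shiftExp p d m) - (1 + PowerSeries.X) ^ 0) * x (j - s) := by rw [pow_zero, sub_mul, one_mul]
  rw [e]
  exact dvd_mul_of_dvd_left (omega_dvd_pow_sub_pow_of_modEq p h0) _

variable [IsAdicComplete (Ideal.span {intBase F (LTCoeff.of F π)}) (PowerSeries 𝒪[F])]
  [CharZero F] (hI : Ideal.span {(p : 𝒪[F])} ≠ ⊤) (hud : ∀ m, (u : LTCoeff F) ^ Module.finrank F (E m) ≠ 1)

omit hp [NeZero d] [IsAdicComplete (Ideal.span {(p : 𝒪[F])}) 𝒪[F]] [CharZero F] in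
/-- `(shift_s G)⁰ = G⁰(· − s)`. [cite: deShalit1987, Ch. I §3.1] -/
theorem constTerm_indexShiftₗ (s : ZMod d) (G : ZMod d → ColemanCoordModule hπ hq (intBase F) u hu γ) :
    constTerm hπ hq u hu γ (indexShiftₗ hπ hq u hu γ s G) = fun j => constTerm hπ hq u hu γ G (j - s) := rfl

include hE hdeg hσ₀ hcoh in
/-- ★ **`N` is stable under the `ℤ/d`-shifts.** [cite: deShalit1987, Ch. I §3.1, §3.8 (17)] -/
theorem indexShiftₗ_mem_unitsImage (s : ZMod d) {G : ZMod d → ColemanCoordModule hπ hq (intBase F) u hu γ}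
    (hG : G ∈ unitsImage hd hπ E hmono hE hdeg hσ₀ hq u hu γ hθ hcoh hI hud) :
    indexShiftₗ hπ hq u hu γ s G ∈ unitsImage hd hπ E hmono hE hdeg hσ₀ hq u hu γ hθ hcoh hI hud := fun m => by
  rw [constTerm_indexShiftₗ]
  exact (hG m).shift hd hE hdeg hσ₀ hθ s

include hE hdeg hσ₀ hcoh in
/-- ★★ **`N` is stable under every Galois operator `𝒯 = σ_v ∘ (C g •) ∘ shift_s`** — with `colemanImage_galAct`: the bijection
`𝒰¹_∞ ≅ N` (`colemanImageEquiv`) is `Γ_F`-equivariant for `σ̃ ↦ 𝒯_{σ̃}`, and `N` is a `Λ(𝒢)`-submodule of `M` for the full Galois group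
`𝒢` of the two-variable local tower. [cite: deShalit1987, Ch. I §3.1, §3.4 Lemma (ii), §3.8 (17); Ch. III §1.3] -/
theorem galOpₗ_mem_unitsImage (v : 𝒪[F]ˣ) (g : PowerSeries 𝒪[F]) (s : ZMod d) {G : ZMod d → ColemanCoordModule hπ hq (intBase F) u hu γ}
    (hG : G ∈ unitsImage hd hπ E hmono hE hdeg hσ₀ hq u hu γ hθ hcoh hI hud) :
    galOpₗ hπ hq u hu γ v g s G ∈ unitsImage hd hπ E hmono hE hdeg hσ₀ hq u hu γ hθ hcoh hI hud := by
  rw [galOpₗ, LinearMap.comp_apply, LinearMap.comp_apply]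
  exact unitTwistₗ_compLeft_mem_unitsImage hπ E hmono hE hdeg hσ₀ hq u hu γ hθ hcoh hI hud v
    (Submodule.smul_mem _ _ (indexShiftₗ_mem_unitsImage hd hπ E hmono hE hdeg hσ₀ hq u hu γ hθ hcoh hI hud s hG))

include hE hdeg hσ₀ hcoh in
/-- ★ **`Col(σ̃·β) ∈ N` and is `𝒯_{σ̃}` of `Col β`**, stated on the subtype: the Galois action on `𝒰¹_∞` transported to `N`.
[cite: deShalit1987, Ch. I §3.8 (17); Ch. III §1.3] -/
theorem galOpₗ_colemanImage_mem_unitsImage (hm : ∃ m₁ : ℕ, LTCoeff.of F π ^ 2 ∣ LTCoeff.of F π - m₁)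
    {β : ∀ m, RelNormCoherentUnits hπ (E m)} (hβ : ∀ m, (β (m + 1)).baseNorm hπ (hmono (Nat.le_succ m)) = β m)
    (hβ1 : ∀ m, ‖(((β m).val 0 : unitBall (E m ⊔ ltField π 0 : IntermediateField F (AlgebraicClosure F))) :
      (E m ⊔ ltField π 0 : IntermediateField F (AlgebraicClosure F))) - 1‖ < 1)
    (σ : absoluteGaloisGroup F) {g : PowerSeries 𝒪[F]} {s : ZMod d}
    (hg : ∀ m, ∃ a : ℕ, (∀ x : E m, σ • (x : AlgebraicClosure F) = (σ₀ ^ a) • (x : AlgebraicClosure F)) ∧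
      ((1 + PowerSeries.X : PowerSeries 𝒪[F]) ^ p ^ m - 1) ∣ g - (1 + PowerSeries.X) ^ a ∧ (a : ZMod d) = s) :
    galOpₗ hπ hq u hu γ (lubinTateChar hπ σ) g s (colemanImage hd hπ E hmono hE hdeg hσ₀ hq u hu γ hθ hcoh hβ) ∈
      unitsImage hd hπ E hmono hE hdeg hσ₀ hq u hu γ hθ hcoh hI hud := by
  rw [← colemanImage_galAct hd hπ E hmono hE hdeg hσ₀ hq u hu γ hθ hcoh hβ σ hg]
  exact colemanImage_mem_unitsImage hd hπ E hmono hE hdeg hσ₀ hq u hu γ hθ hcoh hI hud hm _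
    (galAct_principal hπ E σ hβ1)

end UnitsImageGaloisTwo

end Literature.NumberTheory.GaloisRepresentations
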